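import Literature.NumberTheory.Transcendental.DiazZeroLemmaMult
import Literature.NumberTheory.Transcendental.PhilipponZeroEstimateHolds
import HarnessLib

/-!
# The five exponentials theorem, direct proof — I: the zero estimate step

Topic `Literature/NumberTheory/Transcendental`; sibling proof file of `FiveExponentials.lean`
(the named fact `Literature.NumberTheory.Transcendental.waldschmidt1988_fiveExponentials`,
[Waldschmidt1988, §2 c) Corollary 2.2]). Everything here is PROVED; there are no new definitions
and no new facts.

In print Corollary 2.2 follows from Corollary 2.1 (the strong six exponentials theorem), itself a
case of Theorem 1.1, which §5 deduces from **Theorem 4.1**, proved in §§6–7 from an auxiliary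
polynomial (Proposition 6.1) and Philippon's zero estimate (Proposition 7.1 = [Philippon1986,
Thm 2.1]). The tree's reduction to Corollary 2.1 is `FiveExponentialsProofs.lean`
(`…_of_strongSixExponentials`), whose input `roy1992_strongSixExponentials` rests on the general
Theorem 4.1 (`Literature.Barriers.Schanuel.roy1992_thm1`, a named fact). The present series of
files (`FiveExponentialsZeroEstimate`, `…Auxiliary`, `…Liouville`, `…Holds`) instead runs the
proof of Theorem 4.1 (§§6–7) directly in the configuration of Corollary 2.2, where everything is
explicit: `G = 𝔾ₐ × 𝔾ₘ²` (`d₀ = 1`, `d₁ = 2`, `d = 3`), the hyperplane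
`V = {λu₀ + λu₁ = γu₂} ⊂ Lie G = ℂ × ℂ²` (`n = 2`), the line `W = ℂ·(1; -1, 0) ⊂ V` (`t = 1`,
defined over `ℚ`), and `Y = ℤy₀♯ + ℤy₁♯ + ℤη♯ ⊂ V` of rank `m = 3 > d₁(d - 1 - t) = 2` with
`y_j♯ = (0; γy_j, λy_j)`, `η♯ = (γ; 0, λ)`, after the normalisation `γ = η`, `λ = ηx₂/x₁`,
`y_j ← x₁y_j/η` of the data of Corollary 2.2 (so that `e^{γ y_j}, e^{λ y_j}, e^{λ} ∈ ℚ̄`).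

This file is the step "§7": Philippon's zero estimate on `𝔾ₐ × 𝔾ₘ²` with multiplicities along
`exp_G(W)` — the tree's THEOREM `Philippon1986_GaGm_holds` (`PhilipponZeroEstimateHolds.lean`) —
applied to a non-zero `P ∈ ℂ[X₀, X₁, X₂]` of partial degrees `≤ D₀, D₁, D₁` vanishing to order
`≥ 3T + 1` along `W` at the points `exp_G(μ₀y₀♯ + μ₁y₁♯ + μ₂η♯)`, `0 ≤ μ_k ≤ 3B`, together with the
EXCLUSION OF EVERY OBSTRUCTING SUBGROUP `G' = V' × T_M` (`V' ∈ {0, 𝔾ₐ}`, `M ≤ ℤ²` the characters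
trivial on the subtorus) under six numerical inequalities between `B, T, D₀, D₁` and Philippon's
constant `c` (`zeroEstimate_fiveExp`). In print this exclusion is the computation behind
"`(λ + δ₁ + 2δ₂)(d − n) ≤ (δ − τ)(d₁ + 2d₂ − κ)`" (end of §7, p. 390) followed by §5 and §2 c);
here, with explicit data, it is elementary: writing `ν = μ' − μ` for two points congruent
mod `G'`, the congruences read (`DiazZL.sig_mem_iff`) `ν₂γ = 0` if `V' = 0` and
`(χ₀γ + χ₁λ)(ν₀y₀ + ν₁y₁) + χ₁λν₂ ∈ 2πiℤ` for `χ ∈ M`, and they are decoded with the three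
independence statements `aγ + bλ = 0 ⇒ a = b = 0`, `ay₀ + by₁ + e = 0 ⇒ a = b = e = 0`
(integers `a, b, e`; the second is where Hermite–Lindemann enters, in `…Holds.lean`):

* `M` contains two independent characters: `μ ↦ class` is injective on the box (on the slice
  `μ₂ = 0` if `V' = 𝔾ₐ`), `#classes ≥ (B+1)³` (resp. `(B+1)²`), `s = codim_W(W ∩ Lie G') = 1`;
* `M ≠ 0` of rank one, generated up to torsion by `χ`: `dim T_M ≥ 1`; if `V' = 0`, or `V' = 𝔾ₐ`
  and `χ₀ = 0` (the only case with `W ⊆ Lie G'`, `s = 0`), a class with more than `B + 1` points of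
  the box would contain three non-collinear points (`DiazZL.exists_indep_of_card_gt`), which the
  congruences forbid, so `#classes ≥ (B+1)²`; if `V' = 𝔾ₐ` and `χ₀ ≠ 0` then `s = 1`,
  `#classes ≥ 1`;
* `M = 0`: `V' = 0` gives `#classes ≥ B + 1` (distinct `μ₂`), and `V' = 𝔾ₐ` means `G' = G`, where
  `P` would vanish identically (`DiazZLM.eq_zero_of_evalAt_translate`).

In each case Philippon's inequality
`binom(T+s,s) · #classes · D₀^{dim V'} (2D₁)^{dim T_M} ≤ c · D₀ · (2D₁)²` contradicts one of the six
hypotheses `c D₀ (2D₁)² < …`.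

## References

* [Waldschmidt1988] M. Waldschmidt, *On the transcendence methods of Gel'fond and Schneider in
  several variables*, in: New Advances in Transcendence Theory (A. Baker ed.), Cambridge Univ.
  Press 1988, 375–398: §2 c) Corollary 2.2 (p. 378), §4 Theorem 4.1 (pp. 382–383), §7
  Proposition 7.1 and the end of the proof of Theorem 4.1 (pp. 389–390); held scan
  `book:baker1988-new-advances-transcendence-theory`, pp. 300, 304–305, 311–312.
* [Philippon1986] P. Philippon, *Lemmes de zéros dans les groupes algébriques commutatifs*,
  Bull. Soc. Math. France 114 (1986), 355–383, Théorème 2.1.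
-/

noncomputable section

namespace Literature.NumberTheory.Transcendental

open Finset GaGm DiazZL DiazZLM Complex

namespace Waldschmidt1988

/-! ### The points `exp_G(μ₀y₀♯ + μ₁y₁♯ + μ₂η♯)` of `𝔾ₐ × 𝔾ₘ²`: decoding the congruences -/

/-- The additive coordinate of `ν₀y₀♯ + ν₁y₁♯ + ν₂η♯` is `ν₂γ`. [folklore] -/
theorem sum_theta (γ : ℂ) (ν : Fin 3 → ℤ) :
    ∑ k, (ν k : ℂ) * (![0, 0, γ] : Fin 3 → ℂ) k = ν 2 * γ := by
  simp [Fin.sum_univ_three]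

/-- The pairing of a character `χ ∈ ℤ²` with the toric coordinates
`(γ(ν₀y₀ + ν₁y₁), λ(ν₀y₀ + ν₁y₁ + ν₂))` of `ν₀y₀♯ + ν₁y₁♯ + ν₂η♯`. [folklore] -/
theorem sum_chars_z (γ lam : ℂ) (y : Fin 2 → ℂ) (χ : Fin 2 → ℤ) (ν : Fin 3 → ℤ) :
    ∑ j, (χ j : ℂ) * ∑ k, (ν k : ℂ) *
        (![![γ * y 0, γ * y 1, 0], ![lam * y 0, lam * y 1, lam]] : Fin 2 → Fin 3 → ℂ) j k =
      ((χ 0 : ℂ) * γ + χ 1 * lam) * (ν 0 * y 0 + ν 1 * y 1) + χ 1 * lam * ν 2 := by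
  simp [Fin.sum_univ_two, Fin.sum_univ_three]
  ring

/-- **Two independent characters.** If `χ, χ'` are `ℤ`-independent, `ν₂ = 0`, and both
`(χ₀γ + χ₁λ)(ν₀y₀ + ν₁y₁)` and `(χ₀'γ + χ₁'λ)(ν₀y₀ + ν₁y₁)` lie in `2πiℤ`, then `ν = 0`
(`γ, λ` and `y₀, y₁` being `ℤ`-independent). [folklore] -/
theorem nu_eq_zero_of_two_chars {γ lam : ℂ} {y : Fin 2 → ℂ}
    (hγl : ∀ a b : ℤ, (a : ℂ) * γ + b * lam = 0 → a = 0 ∧ b = 0)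
    (hy : ∀ a b : ℤ, (a : ℂ) * y 0 + b * y 1 = 0 → a = 0 ∧ b = 0)
    {χ χ' : Fin 2 → ℤ} (hind : ∀ a b : ℤ, a • χ + b • χ' = 0 → a = 0 ∧ b = 0)
    {ν : Fin 3 → ℤ} (hν2 : ν 2 = 0) {t t' : ℤ}
    (ht : ((χ 0 : ℂ) * γ + χ 1 * lam) * (ν 0 * y 0 + ν 1 * y 1) = t * (2 * Real.pi * I))
    (ht' : ((χ' 0 : ℂ) * γ + χ' 1 * lam) * (ν 0 * y 0 + ν 1 * y 1) = t' * (2 * Real.pi * I)) :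
    ν = 0 := by
  by_cases hθ : (ν 0 : ℂ) * y 0 + ν 1 * y 1 = 0
  · obtain ⟨h0, h1⟩ := hy (ν 0) (ν 1) hθ
    funext k
    fin_cases k
    · exact h0
    · exact h1
    · exact hν2
  · exfalso
    have key : ((t' * χ 0 - t * χ' 0 : ℤ) : ℂ) * γ + ((t' * χ 1 - t * χ' 1 : ℤ) : ℂ) * lam = 0 := by
      have h3 : ((t' : ℂ) * ((χ 0 : ℂ) * γ + χ 1 * lam) - t * ((χ' 0 : ℂ) * γ + χ' 1 * lam)) *
          ((ν 0 : ℂ) * y 0 + ν 1 * y 1) = 0 := by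
        linear_combination (t' : ℂ) * ht - (t : ℂ) * ht'
      rcases mul_eq_zero.mp h3 with h | h
      · push_cast
        linear_combination h
      · exact absurd h hθ
    obtain ⟨ha, hb⟩ := hγl _ _ key
    have hχχ : t' • χ + (-t) • χ' = 0 := by
      funext j
      fin_cases j
      · simp only [Pi.add_apply, Pi.smul_apply, smul_eq_mul, Pi.zero_apply, Fin.zero_eta]
        linarith
      · simp only [Pi.add_apply, Pi.smul_apply, smul_eq_mul, Pi.zero_apply, Fin.mk_one]
        linarith
    obtain ⟨ht'0, ht0⟩ := hind t' (-t) hχχ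
    have ht0' : t = 0 := by omega
    rw [ht0', Int.cast_zero, zero_mul] at ht
    rcases mul_eq_zero.mp ht with h | h
    · obtain ⟨h0, h1⟩ := hγl (χ 0) (χ 1) h
      have hχ0 : (1 : ℤ) • χ + (0 : ℤ) • χ' = 0 := by
        funext j
        fin_cases j
        · simp [h0]
        · simp [h1]
      exact one_ne_zero (hind 1 0 hχ0).1
    · exact hθ h

/-- **One character, two independent differences.** If `χ ≠ 0`, `ν, ν'` are `ℤ`-independent
with `ν₂ = ν'₂ = 0`, and `(χ₀γ + χ₁λ)(ν₀y₀ + ν₁y₁)`, `(χ₀γ + χ₁λ)(ν'₀y₀ + ν'₁y₁)` both lie in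
`2πiℤ`, we reach a contradiction. [folklore] -/
theorem false_of_one_char_two_nu {γ lam : ℂ} {y : Fin 2 → ℂ}
    (hγl : ∀ a b : ℤ, (a : ℂ) * γ + b * lam = 0 → a = 0 ∧ b = 0)
    (hy : ∀ a b : ℤ, (a : ℂ) * y 0 + b * y 1 = 0 → a = 0 ∧ b = 0)
    {χ : Fin 2 → ℤ} (hχ : χ ≠ 0) {ν ν' : Fin 3 → ℤ} (hν2 : ν 2 = 0) (hν'2 : ν' 2 = 0)
    (hind : ∀ a b : ℤ, (∀ k, a * ν k + b * ν' k = 0) → a = 0 ∧ b = 0) {t t' : ℤ}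
    (ht : ((χ 0 : ℂ) * γ + χ 1 * lam) * (ν 0 * y 0 + ν 1 * y 1) = t * (2 * Real.pi * I))
    (ht' : ((χ 0 : ℂ) * γ + χ 1 * lam) * (ν' 0 * y 0 + ν' 1 * y 1) = t' * (2 * Real.pi * I)) :
    False := by
  have hA : (χ 0 : ℂ) * γ + χ 1 * lam ≠ 0 := by
    intro h
    obtain ⟨h0, h1⟩ := hγl (χ 0) (χ 1) h
    apply hχ
    funext j
    fin_cases j
    · exact h0
    · exact h1
  -- `A · (t'θ_ν − tθ_{ν'}) = 0`
  have h3 : ((χ 0 : ℂ) * γ + χ 1 * lam) *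
      (((t' * ν 0 - t * ν' 0 : ℤ) : ℂ) * y 0 + ((t' * ν 1 - t * ν' 1 : ℤ) : ℂ) * y 1) = 0 := by
    push_cast
    linear_combination (t' : ℂ) * ht - (t : ℂ) * ht'
  rcases mul_eq_zero.mp h3 with h | h
  · exact hA h
  obtain ⟨ha, hb⟩ := hy _ _ h
  obtain ⟨ht'0, ht0⟩ := hind t' (-t) fun k => by
    fin_cases k
    · simp only [Fin.zero_eta]; linarith
    · simp only [Fin.mk_one]; linarith
    · simp only [Fin.reduceFinMk, hν2, hν'2]; ring
  have ht0' : t = 0 := by omega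
  rw [ht0', Int.cast_zero, zero_mul] at ht
  rcases mul_eq_zero.mp ht with h' | h'
  · exact hA h'
  obtain ⟨h0, h1⟩ := hy _ _ h'
  have := (hind 1 0 fun k => by
    fin_cases k
    · simp [h0]
    · simp [h1]
    · simp [hν2]).1
  exact one_ne_zero this

/-- **The character `(0, χ₁)`, two independent differences.** If `χ₁ ≠ 0`, `λ ≠ 0`, `ν, ν'` are
`ℤ`-independent and `χ₁λ(ν₀y₀ + ν₁y₁ + ν₂)`, `χ₁λ(ν'₀y₀ + ν'₁y₁ + ν'₂)` both lie in `2πiℤ`, we reach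
a contradiction (`1, y₀, y₁` being `ℤ`-independent). [folklore] -/
theorem false_of_char01_two_nu {lam : ℂ} {y : Fin 2 → ℂ} (hlam : lam ≠ 0)
    (hy1 : ∀ a b e : ℤ, (a : ℂ) * y 0 + b * y 1 + e = 0 → a = 0 ∧ b = 0 ∧ e = 0)
    {χ1 : ℤ} (hχ1 : χ1 ≠ 0) {ν ν' : Fin 3 → ℤ}
    (hind : ∀ a b : ℤ, (∀ k, a * ν k + b * ν' k = 0) → a = 0 ∧ b = 0) {t t' : ℤ}
    (ht : (χ1 : ℂ) * lam * (ν 0 * y 0 + ν 1 * y 1 + ν 2) = t * (2 * Real.pi * I))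
    (ht' : (χ1 : ℂ) * lam * (ν' 0 * y 0 + ν' 1 * y 1 + ν' 2) = t' * (2 * Real.pi * I)) :
    False := by
  have hA : (χ1 : ℂ) * lam ≠ 0 := mul_ne_zero (by exact_mod_cast hχ1) hlam
  have h3 : (χ1 : ℂ) * lam * (((t' * ν 0 - t * ν' 0 : ℤ) : ℂ) * y 0 +
      ((t' * ν 1 - t * ν' 1 : ℤ) : ℂ) * y 1 + ((t' * ν 2 - t * ν' 2 : ℤ) : ℂ)) = 0 := by
    push_cast
    linear_combination (t' : ℂ) * ht - (t : ℂ) * ht'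
  rcases mul_eq_zero.mp h3 with h | h
  · exact hA h
  obtain ⟨ha, hb, he⟩ := hy1 _ _ _ h
  obtain ⟨ht'0, ht0⟩ := hind t' (-t) fun k => by
    fin_cases k
    · simp only [Fin.zero_eta]; linarith
    · simp only [Fin.mk_one]; linarith
    · simp only [Fin.reduceFinMk]; linarith
  have ht0' : t = 0 := by omega
  rw [ht0', Int.cast_zero, zero_mul] at ht
  rcases mul_eq_zero.mp ht with h' | h'
  · exact hA h'
  obtain ⟨h0, h1, h2⟩ := hy1 _ _ _ h'
  have := (hind 1 0 fun k => by
    fin_cases k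
    · simp [h0]
    · simp [h1]
    · simp [h2]).1
  exact one_ne_zero this

/-- Two dependent characters have vanishing determinant: if `χ ≠ 0` and `aχ + bχ' = 0` with
`(a, b) ≠ (0, 0)` then `χ'₀χ₁ = χ'₁χ₀`. [folklore] -/
theorem det_eq_zero_of_dep {χ χ' : Fin 2 → ℤ} (hχ : χ ≠ 0)
    (h : ∃ a b : ℤ, a • χ + b • χ' = 0 ∧ ¬(a = 0 ∧ b = 0)) : χ' 0 * χ 1 = χ' 1 * χ 0 := by
  obtain ⟨a, b, hab, hne⟩ := h
  have h0 : a * χ 0 + b * χ' 0 = 0 := by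
    have := congrFun hab 0; simpa using this
  have h1 : a * χ 1 + b * χ' 1 = 0 := by
    have := congrFun hab 1; simpa using this
  by_cases hb : b = 0
  · exfalso
    have ha : a ≠ 0 := fun ha => hne ⟨ha, hb⟩
    rw [hb, zero_mul, add_zero] at h0 h1
    apply hχ
    funext j
    fin_cases j
    · exact (mul_eq_zero.mp h0).resolve_left ha
    · exact (mul_eq_zero.mp h1).resolve_left ha
  · have : b * (χ' 0 * χ 1 - χ' 1 * χ 0) = 0 := by linear_combination χ 1 * h0 - χ 0 * h1
    have := (mul_eq_zero.mp this).resolve_left hb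
    linarith

/-! ### The zero estimate step -/

set_option maxHeartbeats 1600000 in
/-- **The zero estimate step of the direct proof of the five exponentials theorem**
(Waldschmidt 1988, §7 — Proposition 7.1 = Philippon's Théorème 2.1 — and the end of the proof of
Theorem 4.1, run for `G = 𝔾ₐ × 𝔾ₘ²`, `W = ℂ·(1; -1, 0)`,
`Γ = ⟨(0; e^{γy₀}, e^{λy₀}), (0; e^{γy₁}, e^{λy₁}), (γ; 1, e^{λ})⟩`). Let `c` be Philippon's constant
for `𝔾ₐ × 𝔾ₘ²` (`Philippon1986_GaGm_holds 2`). Let `γ, λ ∈ ℂ` and `y₀, y₁ ∈ ℂ` satisfy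
`aγ + bλ = 0 ⇒ a = b = 0` and `ay₀ + by₁ + e = 0 ⇒ a = b = e = 0` for integers `a, b, e`. Let
`B, T ≥ 0`, `D₀, D₁ ≥ 1` be integers with
`c D₀ (2D₁)² < (T+1)(B+1)³, (T+1)(B+1)²·2D₁, (T+1)(B+1)(2D₁)², (T+1)(B+1)² D₀, (T+1) D₀ · 2D₁,
(B+1)² D₀ · 2D₁`. Then no non-zero `P ∈ ℂ[X₀, X₁, X₂]` with `deg_{X₀} P ≤ D₀`,
`deg_{X₁} P, deg_{X₂} P ≤ D₁` satisfies `(d/dt)^s P(σ(μ) · exp_G(t(1; -1, 0)))|_{t=0} = 0` for all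
`s ≤ 3T` and all `μ ∈ ℕ³` with `max μ_k ≤ 3B`, where
`σ(μ) = (μ₂γ; e^{γ(μ₀y₀ + μ₁y₁)}, e^{λ(μ₀y₀ + μ₁y₁ + μ₂)})`.
[cite: Waldschmidt1988, §7 Proposition 7.1 and end of proof of Theorem 4.1 (pp. 389–390)]
[cite: Philippon1986, Thm 2.1] -/
theorem zeroEstimate_fiveExp :
    ∃ c : ℕ, ∀ (γ lam : ℂ) (y : Fin 2 → ℂ),
      (∀ a b : ℤ, (a : ℂ) * γ + b * lam = 0 → a = 0 ∧ b = 0) →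
      (∀ a b e : ℤ, (a : ℂ) * y 0 + b * y 1 + e = 0 → a = 0 ∧ b = 0 ∧ e = 0) →
    ∀ (B T D₀ D₁ : ℕ), 1 ≤ D₀ → 1 ≤ D₁ →
      c * D₀ * (2 * D₁) ^ 2 < (T + 1) * (B + 1) ^ 3 →
      c * D₀ * (2 * D₁) ^ 2 < (T + 1) * (B + 1) ^ 2 * (2 * D₁) →
      c * D₀ * (2 * D₁) ^ 2 < (T + 1) * (B + 1) * (2 * D₁) ^ 2 →
      c * D₀ * (2 * D₁) ^ 2 < (T + 1) * (B + 1) ^ 2 * D₀ →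
      c * D₀ * (2 * D₁) ^ 2 < (T + 1) * D₀ * (2 * D₁) →
      c * D₀ * (2 * D₁) ^ 2 < (B + 1) ^ 2 * D₀ * (2 * D₁) →
    ∀ (P : MvPolynomial (Fin 3) ℂ), P ≠ 0 → P.degreeOf 0 ≤ D₀ →
      (∀ h : Fin 2, P.degreeOf h.succ ≤ D₁) →
      (∀ μ : Fin 3 → ℕ, (∀ k, μ k ≤ 3 * B) → ∀ s < 3 * T + 1,
        iteratedDeriv s (fun t : ℂ => evalAt P
          (sig (![0, 0, γ] : Fin 3 → ℂ)
              (![![γ * y 0, γ * y 1, 0], ![lam * y 0, lam * y 1, lam]] : Fin 2 → Fin 3 → ℂ)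
              (fun k => (μ k : ℤ)) * GaGm.exp (t • ((1 : ℂ), (![-1, 0] : Fin 2 → ℂ))))) 0 = 0) →
      False := by
  classical
  obtain ⟨c, hc⟩ := Philippon1986_GaGm_holds 2
  refine ⟨c, ?_⟩
  intro γ lam y hγl hy1 B T D₀ D₁ hD₀ hD₁ h1 h2 h3 h4 h5 h6 P hP0 hdeg₀ hdeg hvan
  -- the three independence statements in the forms used below
  have hy : ∀ a b : ℤ, (a : ℂ) * y 0 + b * y 1 = 0 → a = 0 ∧ b = 0 := fun a b h => by
    have := hy1 a b 0 (by rw [h]; simp)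
    exact ⟨this.1, this.2.1⟩
  have hγ0 : γ ≠ 0 := fun h => by
    have := (hγl 1 0 (by rw [h]; simp)).1
    exact one_ne_zero this
  have hlam0 : lam ≠ 0 := fun h => by
    have := (hγl 0 1 (by rw [h]; simp)).2
    exact one_ne_zero this
  -- notation
  set θ : Fin 3 → ℂ := ![0, 0, γ] with hθdef
  set z : Fin 2 → Fin 3 → ℂ := ![![γ * y 0, γ * y 1, 0], ![lam * y 0, lam * y 1, lam]] with hzdef
  set u' : Fin 2 → ℂ := ![-1, 0] with hu'def
  -- Step 1: the box `[0, B]³` and the points `σ(μ)`.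
  set box : Finset (Fin 3 → ℕ) := Fintype.piFinset fun _ : Fin 3 => Finset.range (B + 1) with hbox
  have hmem_box : ∀ μ : Fin 3 → ℕ, μ ∈ box ↔ ∀ k, μ k ≤ B := fun μ => by
    simp only [hbox, Fintype.mem_piFinset, Finset.mem_range, Nat.lt_succ_iff]
  have hcard_box : box.card = (B + 1) ^ 3 := by
    simp [hbox, Fintype.card_piFinset]
  let toZ : (Fin 3 → ℕ) → Fin 3 → ℤ := fun μ k => (μ k : ℤ)
  let pt : (Fin 3 → ℕ) → GaGm 2 := fun μ => sig θ z (toZ μ)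
  set Sset : Set (GaGm 2) := ↑(box.image pt) with hSset
  have hSfin : Sset.Finite := Finset.finite_toSet _
  have h0box : (0 : Fin 3 → ℕ) ∈ box := (hmem_box 0).mpr fun k => Nat.zero_le _
  have h1S : (1 : GaGm 2) ∈ Sset := by
    rw [hSset, Finset.coe_image]
    refine ⟨0, by exact_mod_cast h0box, ?_⟩
    show sig θ z (toZ 0) = 1
    have : toZ 0 = 0 := by funext k; simp [toZ]
    rw [this, sig_zero]
  -- Step 2: the line `W` and the vanishing on `Σ(3)`.
  set W : Submodule ℂ (ℂ × (Fin 2 → ℂ)) := ℂ ∙ ((1 : ℂ), u') with hWdef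
  have hw : ((1 : ℂ), u') ≠ 0 := fun h0 => one_ne_zero (congrArg Prod.fst h0)
  have hvanS : ∀ g ∈ sumset Sset (2 + 1), VanishesToOrder P W g ((2 + 1) * T + 1) := by
    rintro g ⟨σ', hσ', rfl⟩
    have hex : ∀ i, ∃ μ ∈ box, pt μ = σ' i := fun i => by
      have := hσ' i
      rw [hSset, Finset.coe_image] at this
      obtain ⟨μ, hμ, e⟩ := this
      exact ⟨μ, by exact_mod_cast hμ, e⟩
    choose μ hμbox hμeq using hex
    set Mv : Fin 3 → ℕ := fun k => ∑ i, μ i k with hMv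
    have hMvle : ∀ k, Mv k ≤ 3 * B := fun k => by
      rw [hMv]
      calc ∑ i, μ i k ≤ ∑ _i : Fin (2 + 1), B :=
            Finset.sum_le_sum fun i _ => (hmem_box _).mp (hμbox i) k
        _ = 3 * B := by simp
    have hprod : ∏ i, σ' i = sig θ z (toZ Mv) := by
      have e1 : toZ Mv = ∑ i, toZ (μ i) := by
        funext k; simp [toZ, hMv]
      rw [e1, sig_sum]
      exact Finset.prod_congr rfl fun i _ => (hμeq i).symm
    rw [hprod]
    have h3T : (2 + 1) * T + 1 = 3 * T + 1 := by ring
    rw [h3T]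
    exact vanishesToOrder_of_iteratedDeriv hw (hvan Mv hMvle)
  -- Step 3: the degree data and the zero estimate.
  have hdegtot : ∀ s ∈ P.support, ∑ j : Fin 2, s (Fin.succ j) ≤ 2 * D₁ := by
    intro s hs
    calc ∑ j : Fin 2, s (Fin.succ j) ≤ ∑ _j : Fin 2, D₁ :=
          Finset.sum_le_sum fun j _ => (MvPolynomial.monomial_le_degreeOf j.succ hs).trans (hdeg j)
      _ = 2 * D₁ := by simp
  have h2D₁ : 1 ≤ 2 * D₁ := by omega
  have h2D₁pos : 0 < 2 * D₁ := h2D₁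
  obtain ⟨H, ⟨g, hg⟩, hineq⟩ :=
    hc D₀ (2 * D₁) T W Sset P hD₀ h2D₁ (finrank_line_pos u') hSfin h1S hP0 hdeg₀ hdegtot hvanS
  -- Step 4: classes of the box modulo `G'` and the decoding of a congruence.
  let cls : (Fin 3 → ℕ) → GaGm 2 ⧸ H.toSubgroup := fun μ => (pt μ : GaGm 2 ⧸ H.toSubgroup)
  have hncard : Set.ncard ((QuotientGroup.mk : GaGm 2 → GaGm 2 ⧸ H.toSubgroup) '' Sset) =
      (box.image cls).card := by
    rw [hSset, Finset.coe_image, Set.image_image, ← Finset.coe_image, Set.ncard_coe_finset]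
  rw [hncard] at hineq
  have hcong : ∀ μ μ' : Fin 3 → ℕ, cls μ = cls μ' →
      (H.addPart = false → (toZ μ' - toZ μ) 2 = 0) ∧
      ∀ χ ∈ H.chars, ∃ t : ℤ,
        ((χ 0 : ℂ) * γ + χ 1 * lam) * (((toZ μ' - toZ μ) 0 : ℤ) * y 0 + ((toZ μ' - toZ μ) 1 : ℤ) * y 1) +
          χ 1 * lam * ((toZ μ' - toZ μ) 2 : ℤ) = t * (2 * Real.pi * I) := by
    intro μ μ' heq
    have hmem : sig θ z (toZ μ' - toZ μ) ∈ H.toSubgroup := by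
      rw [← sig_inv_mul]; exact QuotientGroup.eq.mp heq
    rw [sig_mem_iff] at hmem
    simp only [hθdef, hzdef, sum_theta, sum_chars_z] at hmem
    refine ⟨fun hf => ?_, hmem.2⟩
    have := hmem.1 hf
    rcases mul_eq_zero.mp this with h | h
    · exact_mod_cast h
    · exact absurd h hγ0
  have htoZ_inj : ∀ μ μ' : Fin 3 → ℕ, toZ μ' - toZ μ = 0 → μ = μ' := fun μ μ' h => by
    funext k
    have := congrFun h k
    simp only [toZ, Pi.sub_apply, Pi.zero_apply, sub_eq_zero] at this
    exact_mod_cast this.symm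
  have htoZ_sub : ∀ (μ μ' : Fin 3 → ℕ) (k : Fin 3), (toZ μ' - toZ μ) k = (μ' k : ℤ) - μ k :=
    fun μ μ' k => rfl
  -- pigeonhole: either `#classes ≥ (B+1)²` or a class with three non-collinear points
  have hpigeon : (B + 1) ^ 2 ≤ (box.image cls).card ∨
      ∃ μ₀ μ₁ μ₂ : Fin 3 → ℕ, cls μ₀ = cls μ₁ ∧ cls μ₀ = cls μ₂ ∧
        ∀ a b : ℤ, (∀ k, a * ((μ₁ k : ℤ) - μ₀ k) + b * ((μ₂ k : ℤ) - μ₀ k) = 0) → a = 0 ∧ b = 0 := by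
    by_cases hfib : ∀ b ∈ box.image cls, (box.filter fun a => cls a = b).card ≤ B + 1
    · left
      have h3 : box.card ≤ (B + 1) * (box.image cls).card :=
        Finset.card_le_mul_card_image box (B + 1) hfib
      rw [hcard_box, pow_succ, pow_succ, pow_succ, pow_zero, one_mul] at h3
      rw [pow_two]
      exact Nat.le_of_mul_le_mul_right (by simpa [mul_comm, mul_assoc, mul_left_comm] using h3)
        (Nat.succ_pos B)
    · right
      push Not at hfib
      obtain ⟨b, _hb, hcardC⟩ := hfib
      set C : Finset (Fin 3 → ℕ) := box.filter fun a => cls a = b with hCdef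
      have hbx : ∀ μ ∈ C, μ ∈ box := fun μ hμ => (Finset.mem_filter.mp hμ).1
      have hcls : ∀ μ ∈ C, cls μ = b := fun μ hμ => (Finset.mem_filter.mp hμ).2
      have hCbox : ∀ μ ∈ C, ∀ k, μ k ≤ B := fun μ hμ k => (hmem_box μ).mp (hbx μ hμ) k
      obtain ⟨μ₀, hμ₀, μ₁, hμ₁, μ₂, hμ₂, hind⟩ := exists_indep_of_card_gt hCbox hcardC
      exact ⟨μ₀, μ₁, μ₂, by rw [hcls _ hμ₀, hcls _ hμ₁], by rw [hcls _ hμ₀, hcls _ hμ₂], hind⟩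
  have hcard_pos : 1 ≤ (box.image cls).card :=
    Finset.card_pos.mpr ⟨cls 0, Finset.mem_image_of_mem _ h0box⟩
  -- Step 5: the case analysis on `G' = V' × T_M`.
  by_cases hA : ∃ χ ∈ H.chars, ∃ χ' ∈ H.chars, ∀ a b : ℤ, a • χ + b • χ' = 0 → a = 0 ∧ b = 0
  · -- (A) two independent characters: injectivity
    obtain ⟨χ, hχ, χ', hχ', hind⟩ := hA
    have hs1 : ((1 : ℂ), u') ∉ H.tangent := fun hmem' => by
      have hall := ((one_mem_tangent_iff H u').mp hmem').2
      have e0 : ∀ χ'' ∈ H.chars, χ'' 0 = 0 := fun χ'' hχ'' => by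
        have := hall χ'' hχ''
        simp [hu'def, Fin.sum_univ_two] at this
        exact_mod_cast this
      have h10 : (χ' 1) • χ + (-(χ 1)) • χ' = 0 := by
        funext j
        fin_cases j
        · simp [e0 χ hχ, e0 χ' hχ']
        · simp; ring
      obtain ⟨ha, hb⟩ := hind _ _ h10
      have hb' : χ 1 = 0 := by omega
      have hχ0 : (1 : ℤ) • χ + (0 : ℤ) • χ' = 0 := by
        funext j
        fin_cases j
        · simp [e0 χ hχ]
        · simp [hb']
      exact one_ne_zero (hind 1 0 hχ0).1
    have hs := finrank_line_sub_eq_one H u' hs1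
    rw [hs, Nat.choose_one_right] at hineq
    -- injectivity of `cls` on the points with `μ₂ = μ'₂`
    have hinj : ∀ μ μ' : Fin 3 → ℕ, μ 2 = μ' 2 → cls μ = cls μ' → μ = μ' := by
      intro μ μ' h22 heq
      obtain ⟨-, hchar⟩ := hcong μ μ' heq
      have hν2 : (toZ μ' - toZ μ) 2 = 0 := by rw [htoZ_sub, h22]; ring
      obtain ⟨t, ht⟩ := hchar χ hχ
      obtain ⟨t', ht'⟩ := hchar χ' hχ'
      rw [hν2, Int.cast_zero, mul_zero, add_zero] at ht ht'
      exact htoZ_inj μ μ' (nu_eq_zero_of_two_chars hγl hy hind hν2 ht ht')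
    cases hadd : H.addPart with
    | false =>
      -- `V' = 0`: all `(B+1)³` points are pairwise incongruent
      have hinj' : Set.InjOn cls ↑box := by
        intro μ _ μ' _ heq
        have h22 : (toZ μ' - toZ μ) 2 = 0 := (hcong μ μ' heq).1 hadd
        rw [htoZ_sub] at h22
        exact hinj μ μ' (by omega) heq
      have hcard : (box.image cls).card = (B + 1) ^ 3 := by
        rw [Finset.card_image_of_injOn hinj', hcard_box]
      rw [hcard] at hineq
      have haD : H.addDim = 0 := by simp [ConnAlgSubgroup.addDim, hadd]
      rw [haD, pow_zero, mul_one] at hineq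
      have hpow : 1 ≤ (2 * D₁) ^ H.torusDim := Nat.one_le_pow _ _ h2D₁pos
      have : (T + 1) * (B + 1) ^ 3 ≤ c * D₀ * (2 * D₁) ^ 2 :=
        le_trans (Nat.le_mul_of_pos_right _ hpow) hineq
      omega
    | true =>
      -- `V' = 𝔾ₐ`: the slice `μ₂ = 0` injects
      set box0 : Finset (Fin 3 → ℕ) := box.filter fun μ => μ 2 = 0 with hbox0
      have hinj' : Set.InjOn cls ↑box0 := by
        intro μ hμ μ' hμ' heq
        have a := (Finset.mem_filter.mp (Finset.mem_coe.mp hμ)).2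
        have b := (Finset.mem_filter.mp (Finset.mem_coe.mp hμ')).2
        exact hinj μ μ' (by rw [a, b]) heq
      have hcard0 : box0.card = (B + 1) ^ 2 := by
        -- `box0 ≃ [0,B]²` via the first two coordinates
        have e : box0 = (Fintype.piFinset fun k : Fin 3 =>
            if k = 2 then ({0} : Finset ℕ) else Finset.range (B + 1)) := by
          ext μ
          simp only [hbox0, Finset.mem_filter, hmem_box, Fintype.mem_piFinset]
          constructor
          · rintro ⟨hle, h2⟩ k
            by_cases hk : k = 2
            · subst hk; simp [h2]
            · simp [hk, hle k]
          · intro h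
            refine ⟨fun k => ?_, ?_⟩
            · have := h k
              by_cases hk : k = 2
              · subst hk; simp at this; simp [this]
              · simp [hk] at this; exact this
            · have := h 2; simpa using this
        rw [e, Fintype.card_piFinset, Fin.prod_univ_three]
        simp [pow_two]
      have hle : (B + 1) ^ 2 ≤ (box.image cls).card := by
        rw [← hcard0, ← Finset.card_image_of_injOn hinj']
        exact Finset.card_le_card (Finset.image_subset_image (Finset.filter_subset _ _))
      have haD : H.addDim = 1 := by simp [ConnAlgSubgroup.addDim, hadd]
      rw [haD, pow_one] at hineq
      have hpow : 1 ≤ (2 * D₁) ^ H.torusDim := Nat.one_le_pow _ _ h2D₁pos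
      have : (T + 1) * (B + 1) ^ 2 * D₀ ≤ c * D₀ * (2 * D₁) ^ 2 :=
        calc (T + 1) * (B + 1) ^ 2 * D₀ ≤ (T + 1) * (box.image cls).card * D₀ := by gcongr
          _ ≤ (T + 1) * (box.image cls).card * D₀ * (2 * D₁) ^ H.torusDim :=
            Nat.le_mul_of_pos_right _ hpow
          _ ≤ c * D₀ * (2 * D₁) ^ 2 := hineq
      omega
  · push Not at hA
    by_cases hB : ∃ χ ∈ H.chars, χ ≠ 0
    · -- (B) `M ≠ 0` of rank one
      obtain ⟨χ, hχ, hχ0⟩ := hB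
      have hdet : ∀ χ' ∈ H.chars, χ' 0 * χ 1 = χ' 1 * χ 0 := fun χ' hχ' =>
        det_eq_zero_of_dep hχ0 (by
          obtain ⟨a, b, hab, hne⟩ := hA χ hχ χ' hχ'
          exact ⟨a, b, hab, fun h => hne h.1 h.2⟩)
      -- `dim T_M ≥ 1`: the vector `(-χ₁, χ₀)` is tangent
      have hδ1 : 1 ≤ H.torusDim := by
        have hv : (![-(χ 1 : ℂ), χ 0] : Fin 2 → ℂ) ∈ H.torusTangent := by
          rw [mem_torusTangent_iff]
          intro χ' hχ'
          have := hdet χ' hχ'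
          simp only [Fin.sum_univ_two, Matrix.cons_val_zero, Matrix.cons_val_one,
            Matrix.cons_val_fin_one]
          have e : (χ' 0 : ℂ) * -(χ 1 : ℂ) + χ' 1 * χ 0 = ((χ' 1 * χ 0 - χ' 0 * χ 1 : ℤ) : ℂ) := by
            push_cast; ring
          rw [e, ← this, sub_self, Int.cast_zero]
        have hv0 : (⟨_, hv⟩ : H.torusTangent) ≠ 0 := by
          intro h0
          have h0' := congrArg Subtype.val h0
          simp only [ZeroMemClass.coe_zero] at h0'
          apply hχ0
          funext j
          fin_cases j
          · have := congrFun h0' 1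
            simp at this
            exact_mod_cast this
          · have := congrFun h0' 0
            simp at this
            exact_mod_cast this
        exact Module.finrank_pos_iff_exists_ne_zero.mpr ⟨_, hv0⟩
      have hpowδ : 2 * D₁ ≤ (2 * D₁) ^ H.torusDim := by
        calc 2 * D₁ = (2 * D₁) ^ 1 := (pow_one _).symm
          _ ≤ (2 * D₁) ^ H.torusDim := Nat.pow_le_pow_right h2D₁pos hδ1
      cases hadd : H.addPart with
      | false =>
        -- `V' = 0`, `s = 1`, `#classes ≥ (B+1)²`
        have hs1 : ((1 : ℂ), u') ∉ H.tangent := fun hmem' => by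
          have := ((one_mem_tangent_iff H u').mp hmem').1
          rw [hadd] at this
          exact Bool.false_ne_true this
        have hs := finrank_line_sub_eq_one H u' hs1
        rw [hs, Nat.choose_one_right] at hineq
        have haD : H.addDim = 0 := by simp [ConnAlgSubgroup.addDim, hadd]
        rw [haD, pow_zero, mul_one] at hineq
        rcases hpigeon with hN | ⟨μ₀, μ₁, μ₂, h01, h02, hind⟩
        · have : (T + 1) * (B + 1) ^ 2 * (2 * D₁) ≤ c * D₀ * (2 * D₁) ^ 2 :=
            calc (T + 1) * (B + 1) ^ 2 * (2 * D₁)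
                ≤ (T + 1) * (box.image cls).card * (2 * D₁) ^ H.torusDim := by gcongr
              _ ≤ c * D₀ * (2 * D₁) ^ 2 := hineq
          omega
        · exfalso
          obtain ⟨hν2, hch⟩ := hcong μ₀ μ₁ h01
          obtain ⟨hν'2, hch'⟩ := hcong μ₀ μ₂ h02
          have hν2' := hν2 hadd
          have hν'2' := hν'2 hadd
          obtain ⟨t, ht⟩ := hch χ hχ
          obtain ⟨t', ht'⟩ := hch' χ hχ
          rw [hν2', Int.cast_zero, mul_zero, add_zero] at ht
          rw [hν'2', Int.cast_zero, mul_zero, add_zero] at ht'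
          exact false_of_one_char_two_nu hγl hy hχ0 hν2' hν'2' hind ht ht'
      | true =>
        have haD : H.addDim = 1 := by simp [ConnAlgSubgroup.addDim, hadd]
        rw [haD, pow_one] at hineq
        by_cases hχ00 : χ 0 = 0
        · -- `χ = (0, χ₁)`: `W ⊆ Lie G'`, `s = 0`, `#classes ≥ (B+1)²`
          have hχ1 : χ 1 ≠ 0 := fun h1 => hχ0 (by
            funext j; fin_cases j
            · exact hχ00
            · exact h1)
          have hall0 : ∀ χ' ∈ H.chars, χ' 0 = 0 := fun χ' hχ' => by
            have := hdet χ' hχ'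
            rw [hχ00, mul_zero] at this
            exact (mul_eq_zero.mp this).resolve_right hχ1
          have htan : ((1 : ℂ), u') ∈ H.tangent := by
            rw [one_mem_tangent_iff]
            refine ⟨hadd, fun χ' hχ' => ?_⟩
            simp [hu'def, Fin.sum_univ_two, hall0 χ' hχ']
          have hs0 : Module.finrank ℂ ↥W - Module.finrank ℂ ↥(W ⊓ H.tangent) = 0 := by
            have : W ⊓ H.tangent = W :=
              inf_eq_left.mpr ((Submodule.span_singleton_le_iff_mem _ _).mpr htan)
            rw [this, Nat.sub_self]
          rw [hs0, Nat.choose_zero_right, one_mul] at hineq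
          rcases hpigeon with hN | ⟨μ₀, μ₁, μ₂, h01, h02, hind⟩
          · have : (B + 1) ^ 2 * D₀ * (2 * D₁) ≤ c * D₀ * (2 * D₁) ^ 2 :=
              calc (B + 1) ^ 2 * D₀ * (2 * D₁)
                  ≤ (box.image cls).card * D₀ * (2 * D₁) ^ H.torusDim := by gcongr
                _ ≤ c * D₀ * (2 * D₁) ^ 2 := hineq
            omega
          · exfalso
            obtain ⟨-, hch⟩ := hcong μ₀ μ₁ h01
            obtain ⟨-, hch'⟩ := hcong μ₀ μ₂ h02
            obtain ⟨t, ht⟩ := hch χ hχ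
            obtain ⟨t', ht'⟩ := hch' χ hχ
            rw [hχ00, Int.cast_zero, zero_mul, zero_add] at ht ht'
            refine false_of_char01_two_nu hlam0 hy1 hχ1 hind (t := t) (t' := t') ?_ ?_
            · rw [← ht]; simp only [htoZ_sub]; push_cast; ring
            · rw [← ht']; simp only [htoZ_sub]; push_cast; ring
        · -- `χ₀ ≠ 0`: `s = 1`, one class suffices
          have hs1 : ((1 : ℂ), u') ∉ H.tangent := fun hmem' => by
            have := ((one_mem_tangent_iff H u').mp hmem').2 χ hχ
            simp [hu'def, Fin.sum_univ_two] at this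
            exact hχ00 (by exact_mod_cast this)
          have hs := finrank_line_sub_eq_one H u' hs1
          rw [hs, Nat.choose_one_right] at hineq
          have : (T + 1) * D₀ * (2 * D₁) ≤ c * D₀ * (2 * D₁) ^ 2 :=
            calc (T + 1) * D₀ * (2 * D₁) = (T + 1) * 1 * D₀ * (2 * D₁) := by ring
              _ ≤ (T + 1) * (box.image cls).card * D₀ * (2 * D₁) ^ H.torusDim := by gcongr
              _ ≤ c * D₀ * (2 * D₁) ^ 2 := hineq
          omega
    · -- (C) `M = 0`
      push Not at hB
      cases hadd : H.addPart with
      | false =>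
        -- `V' = 0`: the `B + 1` points `μ = (0, 0, μ₂)` are pairwise incongruent; `dim T_M = 2`
        have hs1 : ((1 : ℂ), u') ∉ H.tangent := fun hmem' => by
          have := ((one_mem_tangent_iff H u').mp hmem').1
          rw [hadd] at this
          exact Bool.false_ne_true this
        have hs := finrank_line_sub_eq_one H u' hs1
        rw [hs, Nat.choose_one_right] at hineq
        have haD : H.addDim = 0 := by simp [ConnAlgSubgroup.addDim, hadd]
        rw [haD, pow_zero, mul_one] at hineq
        have hδ2 : H.torusDim = 2 := by
          have htop : H.torusTangent = ⊤ := by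
            rw [eq_top_iff]
            intro v _
            rw [mem_torusTangent_iff]
            intro χ' hχ'
            simp [hB χ' hχ']
          unfold ConnAlgSubgroup.torusDim
          rw [htop, finrank_top, Module.finrank_fin_fun]
        rw [hδ2] at hineq
        set box2 : Finset (Fin 3 → ℕ) := box.filter fun μ => μ 0 = 0 ∧ μ 1 = 0 with hbox2
        have hinj' : Set.InjOn cls ↑box2 := by
          intro μ hμ μ' hμ' heq
          have a := (Finset.mem_filter.mp (Finset.mem_coe.mp hμ)).2
          have b := (Finset.mem_filter.mp (Finset.mem_coe.mp hμ')).2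
          have h22 : (toZ μ' - toZ μ) 2 = 0 := (hcong μ μ' heq).1 hadd
          rw [htoZ_sub] at h22
          funext k
          fin_cases k
          · simp only [Fin.zero_eta]; rw [a.1, b.1]
          · simp only [Fin.mk_one]; rw [a.2, b.2]
          · simp only [Fin.reduceFinMk]; omega
        have hcard2 : box2.card = B + 1 := by
          have e : box2 = (Fintype.piFinset fun k : Fin 3 =>
              if k = 2 then Finset.range (B + 1) else ({0} : Finset ℕ)) := by
            ext μ
            simp only [hbox2, Finset.mem_filter, hmem_box, Fintype.mem_piFinset]
            constructor
            · rintro ⟨hle, h0, h1'⟩ k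
              fin_cases k
              · simp [h0]
              · simp [h1']
              · simp [hle 2]
            · intro h
              have h0 := h 0
              have h1' := h 1
              have h2 := h 2
              simp at h0 h1' h2
              refine ⟨fun k => ?_, h0, h1'⟩
              fin_cases k
              · simp [h0]
              · simp [h1']
              · exact h2
          rw [e, Fintype.card_piFinset, Fin.prod_univ_three]
          simp
        have hle : B + 1 ≤ (box.image cls).card := by
          rw [← hcard2, ← Finset.card_image_of_injOn hinj']
          exact Finset.card_le_card (Finset.image_subset_image (Finset.filter_subset _ _))
        have : (T + 1) * (B + 1) * (2 * D₁) ^ 2 ≤ c * D₀ * (2 * D₁) ^ 2 :=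
          calc (T + 1) * (B + 1) * (2 * D₁) ^ 2 ≤ (T + 1) * (box.image cls).card * (2 * D₁) ^ 2 := by
                gcongr
            _ ≤ c * D₀ * (2 * D₁) ^ 2 := hineq
        omega
      | true =>
        -- `G' = G`: `P` would vanish identically
        exact absurd (eq_zero_of_evalAt_translate P hdeg H hadd
          (fun χ' hχ' hne => absurd (hB χ' hχ') hne) g hg) hP0

end Waldschmidt1988

end Literature.NumberTheory.Transcendental
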